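import Summits.AtomisticToContinuum.HydrodynamicLimit.Theses.AnnealedZeroHorizon
import HarnessLib

/-!
# Route `AnnealedZeroHorizon` — posited objects of the crux line `AnnealedWeakStrong`

Objects (no statements, no facts) shared by the stub files and the composition of the crux
`AnnealedZeroHorizon.AnnealedWeakStrong` (item stmt-AtomisticToContinuum-9258, line `registered` =
`Cruxes/AnnealedWeakStrong/Lines/birth.lean`). They are the vocabulary of the annealed
Fjordholm–Lye–Mishra–Weber weak–strong argument (FjordholmEtAl2020, Lemma 28 with `M = 1`)
transplanted to the hard-sphere gas at fixed reduced density, with the Dafermos / Březina–Feireisl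
relative entropy of the hard-sphere equation of state as Lyapunov quantity:

* `AWS.State`, `AWS.consState`, `AWS.mollState` — conserved variables `U = (ρ, m, E)`, the state
  `(ρ, ρu, E(ρ,u,θ))` of the classical solution, and the `k`-mollified empirical fields of a
  configuration (verbatim the `R, Mv, En` of the route's `MeanFluxClosure` / `MeanSecondLaw`);
* `AWS.IsKernel ℓ k` — verbatim the kernel clause of `MeanFluxClosure` / `MeanSecondLaw`;
* `AWS.hsEta σ` — the mathematical entropy `η_σ(U) = −ρ(3/2 log θ(U) − log ρ − f_ex(ρσ³))` in
  conserved variables (verbatim the integrand of `MeanSecondLaw` and the function of the landed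
  `BoxDissipativeWeakStrong.HsEntropyConvex`), and `AWS.hsRelEta σ U V` its Bregman divergence
  `η_σ(U) − η_σ(V) − Dη_σ(V)(U − V)` (`fderiv`);
* `AWS.stateDist`, `AWS.relEntropyObs`, `AWS.fieldDistObs` — the `L¹`-type state distance and the two
  coarse-grained observables `z ↦ ∫ η_σ(U^k(Φ_t z)(x) | Ū(t,x)) dx`, `z ↦ ∫ dist(U^k(Φ_t z)(x), Ū(t,x)) dx`;
* `AWS.RelEntropySmallAt`, `AWS.MeanFieldsCloseAt` — "mean relative entropy at time `t` is small" and
  "mollified fields are close in `L¹(P ⊗ dx)` at time `t`", both in the route's double-limit format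
  `∀ ε > 0 ∃ ℓ > 0 ∀ k ∈ Kernel(ℓ), eventually in N, ≤ ε`.

Lean conventions (documented junk): `hsEta` inherits `Real.log 0 = 0`, `x / 0 = 0` and the
`limsup`-defined `hsExcessFreeEnergy` of the route's `MeanSecondLaw`; `hsRelEta` uses `fderiv`
(junk `0` where `hsEta σ` is not differentiable — it is differentiable at every state of a dilute
classical solution, `ImplosionDichotomy.HsEosLowDensity`). Nothing here restates the crux, the route's
items or the Statement. References: FjordholmEtAl2020 (Lemma 28), Dafermos1979, BrezinaFeireisl2018 (§3).
-/

noncomputable section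

open MeasureTheory Filter Set
open scoped ENNReal Topology

namespace Summit.AtomisticToContinuum.HydrodynamicLimit.Theorems.AWS

open Literature.MathematicalPhysics.KineticTheory Literature.Analysis.FluidPDE

/-- State space of the conserved variables `U = (ρ, m, E)` (density, momentum, total energy);
the domain type of `BoxDissipativeWeakStrong.HsEntropyConvex`. -/
abbrev State : Type := ℝ × V3 × ℝ

/-- The conserved state `(ρ, ρu, E(ρ,u,θ))` of the strong (classical) solution at one point. -/
def consState (r : ℝ) (w : V3) (ϑ : ℝ) : State :=
  (r, r • w, totalEnergyDensity r w ϑ)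

/-- The `k`-mollified empirical conserved fields of a configuration `z` at the point `x`:
`(ρ^k, m^k, E^k)(x) = (⟨ρ_N, k(x − ·)⟩, ⟨m_N, k(x − ·)⟩, ⟨E_N, k(x − ·)⟩)` — verbatim the `R, Mv, En`
of the route's `MeanFluxClosure` / `MeanSecondLaw`. -/
def mollState {n : ℕ} (k : T3 → ℝ) (z : Config n (Fin 3) T3) (x : T3) : State :=
  (empiricalDensityField z (fun y => k (x - y)), empiricalMomentumField z (fun y => k (x - y)),
    empiricalEnergyField z (fun y => k (x - y)))

/-- Admissible mollifier at radius `ℓ`: verbatim the kernel clause of `MeanFluxClosure` /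
`MeanSecondLaw` (continuous, non-negative, mass one, supported in the open minimal-image `ℓ`-ball). -/
def IsKernel (ℓ : ℝ) (k : T3 → ℝ) : Prop :=
  Continuous k ∧ (∀ y, 0 ≤ k y) ∧ (∫ y, k y = 1) ∧
    (∀ y, k y ≠ 0 → Literature.Analysis.FluidPDE.Torus.euclidDist y 0 < ℓ)

/-- The mathematical entropy `η_σ(U) = −ρ(3/2 log θ(U) − log ρ − f_ex(ρσ³))`,
`θ(U) = ⅔(E/ρ − |m|²/(2ρ²))`, in conserved variables — verbatim the integrand of `MeanSecondLaw` and
the function of the landed `BoxDissipativeWeakStrong.HsEntropyConvex` (strictly convex on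
`{ρ > 0, ρσ³ < η₀, |m|² < 2ρE}`). Junk conventions (`Real.log 0 = 0`, `x/0 = 0`) as in the route. -/
def hsEta (σ : ℝ) (U : State) : ℝ :=
  -(U.1 * (3 / 2 * Real.log (2 / 3 * (U.2.2 / U.1 - ‖U.2.1‖ ^ 2 / (2 * U.1 ^ 2))) - Real.log U.1 -
      hsExcessFreeEnergy (U.1 * σ ^ 3)))

/-- The relative entropy (Bregman divergence) `η_σ(U | V) = η_σ(U) − η_σ(V) − Dη_σ(V)(U − V)` of
Dafermos / Březina–Feireisl / Fjordholm–Lye–Mishra–Weber, with the Fréchet derivative of `η_σ` at the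
reference state `V` (`fderiv`, junk `0` where `hsEta σ` is not differentiable at `V`). -/
def hsRelEta (σ : ℝ) (U V : State) : ℝ :=
  hsEta σ U - hsEta σ V - (fderiv ℝ (hsEta σ) V) (U - V)

/-- The `L¹`-type distance of two states used for mean convergence of the fields
(same integrand as the landed `BoxDissipativeWeakStrong.LocalGibbsFineScale`). -/
def stateDist (U V : State) : ℝ :=
  |U.1 - V.1| + ‖U.2.1 - V.2.1‖ + |U.2.2 - V.2.2|

/-- The coarse-grained relative-entropy observable of one configuration at time `t`:
`z ↦ ∫ η_σ(U^k(Φ_t z)(x) | Ū(t,x)) dx` (Bochner integral over `𝕋³`). -/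
def relEntropyObs (σ : ℝ) (ρ : ℝ → T3 → ℝ) (u : ℝ → T3 → V3) (θ : ℝ → T3 → ℝ) (N : ℕ)
    (Φ : HardSphereFlow (Literature.Analysis.FluidPDE.Torus.geometry (Fin 3)) (hsDiameter σ N) (N + 1))
    (k : T3 → ℝ) (t : ℝ) (z : Config (N + 1) (Fin 3) T3) : ℝ :=
  ∫ x, hsRelEta σ (mollState k (Φ.flow t z) x) (consState (ρ t x) (u t x) (θ t x))

/-- The coarse-grained `L¹(dx)` field-distance observable of one configuration at time `t`:
`z ↦ ∫ (|ρ^k − ρ| + ‖m^k − ρu‖ + |E^k − E|)(t, x) dx`. -/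
def fieldDistObs (σ : ℝ) (ρ : ℝ → T3 → ℝ) (u : ℝ → T3 → V3) (θ : ℝ → T3 → ℝ) (N : ℕ)
    (Φ : HardSphereFlow (Literature.Analysis.FluidPDE.Torus.geometry (Fin 3)) (hsDiameter σ N) (N + 1))
    (k : T3 → ℝ) (t : ℝ) (z : Config (N + 1) (Fin 3) T3) : ℝ :=
  ∫ x, stateDist (mollState k (Φ.flow t z) x) (consState (ρ t x) (u t x) (θ t x))

/-- **Mean relative entropy is small at time `t`** (the annealed Lyapunov quantity, route
double-limit format): for every `ε > 0` there is a radius `ℓ > 0` such that for every admissible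
mollifier `k` supported in the `ℓ`-ball, eventually in `N`, the relative-entropy observable at time
`t` is integrable under the local Gibbs law and has expectation `≤ ε`. -/
def RelEntropySmallAt (σ : ℝ) (a₀ : T3 → ℝ) (u₀ : T3 → V3) (θ₀ : T3 → ℝ)
    (Φ : (N : ℕ) → HardSphereFlow (Literature.Analysis.FluidPDE.Torus.geometry (Fin 3)) (hsDiameter σ N) (N + 1))
    (ρ : ℝ → T3 → ℝ) (u : ℝ → T3 → V3) (θ : ℝ → T3 → ℝ) (t : ℝ) : Prop :=
  ∀ ε : ℝ, 0 < ε → ∃ ℓ : ℝ, 0 < ℓ ∧ ∀ k : T3 → ℝ, IsKernel ℓ k → ∀ᶠ N in atTop,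
    Integrable (relEntropyObs σ ρ u θ N (Φ N) k t) (localGibbsLaw σ a₀ u₀ θ₀ N (Φ N)) ∧
      ∫ z, relEntropyObs σ ρ u θ N (Φ N) k t z ∂(localGibbsLaw σ a₀ u₀ θ₀ N (Φ N)) ≤ ε

/-- **Mollified fields are close in mean at time `t`** (`L¹(P ⊗ dx)` as a lower integral, route
double-limit format): for every `ε > 0` there is `ℓ > 0` such that for every admissible mollifier
supported in the `ℓ`-ball, eventually in `N`, `E ∫ (|ρ^k − ρ| + ‖m^k − ρu‖ + |E^k − E|)(t,x) dx ≤ ε`. -/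
def MeanFieldsCloseAt (σ : ℝ) (a₀ : T3 → ℝ) (u₀ : T3 → V3) (θ₀ : T3 → ℝ)
    (Φ : (N : ℕ) → HardSphereFlow (Literature.Analysis.FluidPDE.Torus.geometry (Fin 3)) (hsDiameter σ N) (N + 1))
    (ρ : ℝ → T3 → ℝ) (u : ℝ → T3 → V3) (θ : ℝ → T3 → ℝ) (t : ℝ) : Prop :=
  ∀ ε : ℝ, 0 < ε → ∃ ℓ : ℝ, 0 < ℓ ∧ ∀ k : T3 → ℝ, IsKernel ℓ k → ∀ᶠ N in atTop,
    ∫⁻ z, ENNReal.ofReal (fieldDistObs σ ρ u θ N (Φ N) k t z) ∂(localGibbsLaw σ a₀ u₀ θ₀ N (Φ N)) ≤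
      ENNReal.ofReal ε

/-! ### Unfolding lemmas (definitional; for `rw` in the stub files) -/

/-- Components of `consState`. -/
@[simp] theorem consState_fst (r : ℝ) (w : V3) (ϑ : ℝ) : (consState r w ϑ).1 = r := rfl

/-- Components of `consState`. -/
@[simp] theorem consState_snd_fst (r : ℝ) (w : V3) (ϑ : ℝ) : (consState r w ϑ).2.1 = r • w := rfl

/-- Components of `consState`. -/
@[simp] theorem consState_snd_snd (r : ℝ) (w : V3) (ϑ : ℝ) :
    (consState r w ϑ).2.2 = totalEnergyDensity r w ϑ := rfl

/-- Components of `mollState`. -/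
@[simp] theorem mollState_fst {n : ℕ} (k : T3 → ℝ) (z : Config n (Fin 3) T3) (x : T3) :
    (mollState k z x).1 = empiricalDensityField z (fun y => k (x - y)) := rfl

/-- Components of `mollState`. -/
@[simp] theorem mollState_snd_fst {n : ℕ} (k : T3 → ℝ) (z : Config n (Fin 3) T3) (x : T3) :
    (mollState k z x).2.1 = empiricalMomentumField z (fun y => k (x - y)) := rfl

/-- Components of `mollState`. -/
@[simp] theorem mollState_snd_snd {n : ℕ} (k : T3 → ℝ) (z : Config n (Fin 3) T3) (x : T3) :
    (mollState k z x).2.2 = empiricalEnergyField z (fun y => k (x - y)) := rfl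

/-- `stateDist` is non-negative. -/
theorem stateDist_nonneg (U V : State) : 0 ≤ stateDist U V := by
  unfold stateDist; positivity

/-- `stateDist U U = 0`. -/
@[simp] theorem stateDist_self (U : State) : stateDist U U = 0 := by
  simp [stateDist]

/-- The Bregman divergence vanishes on the diagonal: `η_σ(U | U) = 0` (whatever the value of the
`fderiv`, it is applied to `U − U = 0`). -/
@[simp] theorem hsRelEta_self (σ : ℝ) (U : State) : hsRelEta σ U U = 0 := by
  simp [hsRelEta]

/-- **Registered bookkeeping stub S0 `stub_objects`** of the line `registered` (crux
stmt-AtomisticToContinuum-9258): the relative entropy vanishes on the diagonal, the state distance is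
non-negative and vanishes on the diagonal. Anchors this objects module to the crux (`--supports`). -/
theorem stub_objects :
    (∀ (σ : ℝ) (U : State), hsRelEta σ U U = 0) ∧ (∀ U V : State, 0 ≤ stateDist U V) ∧
      (∀ U : State, stateDist U U = 0) :=
  ⟨hsRelEta_self, stateDist_nonneg, stateDist_self⟩

/-! ### Appended 2026-08-17 (lead c1, reshape of S3): the single-kernel field-closeness currency -/

/-- **Mollified fields are close in mean at time `t` along SOME admissible kernels of arbitrarily small
radius** (the currency between the coercivity stub and the test-function stub of the reshaped S3): for
every `ε > 0` and every radius bound `ℓ₀ > 0` there are a radius `0 < ℓ ≤ ℓ₀` and ONE admissible kernel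
`k ∈ Kernel(ℓ)` with, eventually in `N`, `E ∫ (|ρ^k − ρ| + ‖m^k − ρu‖ + |E^k − E|)(t,x) dx ≤ ε`. Weaker than
`MeanFieldsCloseAt` (all kernels) — `MeanFieldsCloseAt → FieldsCloseViaKernelsAt` given a kernel at every
radius — and exactly what the passage to `TendstoHydroFieldsAt` consumes (the prover of that step picks the
kernel; kernels with polynomial boundary decay keep the coarse-grained entropy `x`-integrable). -/
def FieldsCloseViaKernelsAt (σ : ℝ) (a₀ : T3 → ℝ) (u₀ : T3 → V3) (θ₀ : T3 → ℝ)
    (Φ : (N : ℕ) → HardSphereFlow (Literature.Analysis.FluidPDE.Torus.geometry (Fin 3)) (hsDiameter σ N) (N + 1))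
    (ρ : ℝ → T3 → ℝ) (u : ℝ → T3 → V3) (θ : ℝ → T3 → ℝ) (t : ℝ) : Prop :=
  ∀ ε : ℝ, 0 < ε → ∀ ℓ₀ : ℝ, 0 < ℓ₀ → ∃ ℓ : ℝ, 0 < ℓ ∧ ℓ ≤ ℓ₀ ∧ ∃ k : T3 → ℝ, IsKernel ℓ k ∧
    ∀ᶠ N in atTop,
      ∫⁻ z, ENNReal.ofReal (fieldDistObs σ ρ u θ N (Φ N) k t z) ∂(localGibbsLaw σ a₀ u₀ θ₀ N (Φ N)) ≤
        ENNReal.ofReal ε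

/-- Admissible kernels are monotone in the radius: `Kernel(ℓ) ⊆ Kernel(ℓ')` for `ℓ ≤ ℓ'`. -/
theorem IsKernel.mono {ℓ ℓ' : ℝ} {k : T3 → ℝ} (hk : IsKernel ℓ k) (h : ℓ ≤ ℓ') : IsKernel ℓ' k :=
  ⟨hk.1, hk.2.1, hk.2.2.1, fun y hy => lt_of_lt_of_le (hk.2.2.2 y hy) h⟩

/-- `MeanFieldsCloseAt` (all kernels of some radius) implies `FieldsCloseViaKernelsAt` as soon as every
radius carries at least one admissible kernel. -/
theorem MeanFieldsCloseAt.fieldsCloseViaKernelsAt {σ : ℝ} {a₀ : T3 → ℝ} {u₀ : T3 → V3} {θ₀ : T3 → ℝ}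
    {Φ : (N : ℕ) → HardSphereFlow (Literature.Analysis.FluidPDE.Torus.geometry (Fin 3)) (hsDiameter σ N) (N + 1)}
    {ρ : ℝ → T3 → ℝ} {u : ℝ → T3 → V3} {θ : ℝ → T3 → ℝ} {t : ℝ}
    (hex : ∀ ℓ : ℝ, 0 < ℓ → ∃ k : T3 → ℝ, IsKernel ℓ k)
    (h : MeanFieldsCloseAt σ a₀ u₀ θ₀ Φ ρ u θ t) : FieldsCloseViaKernelsAt σ a₀ u₀ θ₀ Φ ρ u θ t := by
  intro ε hε ℓ₀ hℓ₀
  obtain ⟨ℓ, hℓ, H⟩ := h ε hε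
  obtain ⟨k, hk⟩ := hex (min ℓ ℓ₀) (lt_min hℓ hℓ₀)
  exact ⟨min ℓ ℓ₀, lt_min hℓ hℓ₀, min_le_right _ _, k, hk, H k (hk.mono (min_le_left _ _))⟩

/-! ### Appended 2026-08-17 (lead c1, wave-1 integration): the junk-free relative-entropy currency

The Bochner observable `relEntropyObs` (and hence `RelEntropySmallAt`) takes the junk value `0` at every
configuration whose coarse-grained relative-entropy density is not `x`-integrable; for hard spheres this
cannot be excluded in the tree (the mollified packing `ρ^k σ³` visits `[0, 6/π]`, where nothing is provable
about `hsExcessFreeEnergy` above the analytic band; S3b worker report, lead dossier R3). The reshaped line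
therefore passes S2 → S3 through the iterated LOWER integral of `ofReal η_σ(·|·)`, which needs no
integrability or measurability and is consumed by S3b for ALL kernels. -/

/-- **Mean relative entropy small at time `t`, junk-free currency**: for every `ε > 0` there is `ℓ > 0`
such that for every admissible kernel of radius `ℓ`, eventually in `N`, the iterated lower integral
`E ∫⁻ₓ ofReal η_σ(U^k(Φ_t z)(x) | Ū(t,x))` is `≤ ε` (no integrability clause, no Bochner junk; `ofReal` clips
the — Liouville-null or vanishing-density — junk states where `η_σ(·|·) < 0`). -/
def RelEntropyLIntSmallAt (σ : ℝ) (a₀ : T3 → ℝ) (u₀ : T3 → V3) (θ₀ : T3 → ℝ)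
    (Φ : (N : ℕ) → HardSphereFlow (Literature.Analysis.FluidPDE.Torus.geometry (Fin 3)) (hsDiameter σ N) (N + 1))
    (ρ : ℝ → T3 → ℝ) (u : ℝ → T3 → V3) (θ : ℝ → T3 → ℝ) (t : ℝ) : Prop :=
  ∀ ε : ℝ, 0 < ε → ∃ ℓ : ℝ, 0 < ℓ ∧ ∀ k : T3 → ℝ, IsKernel ℓ k → ∀ᶠ N in atTop,
    ∫⁻ z, (∫⁻ x, ENNReal.ofReal (hsRelEta σ (mollState k ((Φ N).flow t z) x)
      (consState (ρ t x) (u t x) (θ t x)))) ∂(localGibbsLaw σ a₀ u₀ θ₀ N (Φ N)) ≤ ENNReal.ofReal ε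

/-- `RelEntropyLIntSmallAt` is monotone in the radius witness: a radius that works may be shrunk. -/
theorem RelEntropyLIntSmallAt.of_le {σ : ℝ} {a₀ : T3 → ℝ} {u₀ : T3 → V3} {θ₀ : T3 → ℝ}
    {Φ : (N : ℕ) → HardSphereFlow (Literature.Analysis.FluidPDE.Torus.geometry (Fin 3)) (hsDiameter σ N) (N + 1)}
    {ρ : ℝ → T3 → ℝ} {u : ℝ → T3 → V3} {θ : ℝ → T3 → ℝ} {t ε ℓ ℓ' : ℝ} (hℓ' : ℓ' ≤ ℓ)
    (h : ∀ k : T3 → ℝ, IsKernel ℓ k → ∀ᶠ N in atTop,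
      ∫⁻ z, (∫⁻ x, ENNReal.ofReal (hsRelEta σ (mollState k ((Φ N).flow t z) x)
        (consState (ρ t x) (u t x) (θ t x)))) ∂(localGibbsLaw σ a₀ u₀ θ₀ N (Φ N)) ≤ ENNReal.ofReal ε) :
    ∀ k : T3 → ℝ, IsKernel ℓ' k → ∀ᶠ N in atTop,
      ∫⁻ z, (∫⁻ x, ENNReal.ofReal (hsRelEta σ (mollState k ((Φ N).flow t z) x)
        (consState (ρ t x) (u t x) (θ t x)))) ∂(localGibbsLaw σ a₀ u₀ θ₀ N (Φ N)) ≤ ENNReal.ofReal ε :=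
  fun k hk => h k (hk.mono hℓ')

end Summit.AtomisticToContinuum.HydrodynamicLimit.Theorems.AWS

end
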